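import Literature.NumberTheory.K2Lit.DoubledLineThetaKernel
import HarnessLib

/-!
# The doubled line theta lift on `H(𝔸)` is left `H(L⁺)`-invariant (automorphy in `h`) — organ O42a of socket #42

Track B ∕ hLiu418 = stmt-HodgeConjecture-24832, line `K2_Liu_CurveThetaSigs`, unit U6 «FIRST TERM AT THE TOP POLE» (the s5 seam); seat
`hodgecm-mathlib-K2Liu-p03` (g2) on K2Liu-plan's «=» (2026-09-03 23:25Z). Helper over the DEFS leaf ★ D8
`Literature/NumberTheory/K2Lit/DoubledLineThetaKernel.lean` (K2Liu-plan, p855547): the doubled line theta lift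
`Θ̃_Φ(f)(h) = ∫_{[U(⟨a'⟩)]} f(q) · θ_Φ((toDiagA h)⁻¹ Γ, q) dμW(q)` (★ `doubledLineThetaLift`) and the theta integral `I(h; Φ)` (★ `doubledLineThetaIntegral`)
are functions on `H(L⁺) \ H(𝔸)`: `Θ̃_Φ(f)(γ h) = Θ̃_Φ(f)(h)` for `γ ∈ H(L⁺)` (★ `GRConstruction.ratH`), because the kernel's first variable is the coset
`(toDiagA h)⁻¹ · U(𝔻)(L⁺)` and `(γh)⁻¹ = h⁻¹ γ⁻¹`. Socket #42 `sig_K2LiuEisensteinResidueIsThetaIntegral` writes the residue `R = Res_{s=½} E⋆` as a finite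
sum of these integrals; #41's clause «`Es s` left `ratH`-invariant» passes to the limit, and this file certifies the same invariance on the theta side.

* `subgroupCongr_mem_range_toAdelic` — transport of rational points along an equality of forms `J = J'` (generic in the frame `(F, E, c, N)`).
* `toDiagA_mem_range_toAdelic` — `toDiagA γ ∈ U(diagonal dD)(L⁺)` for `γ ∈ H(L⁺)`.
* `doubledLineThetaLift_ratH_mul`, `doubledLineThetaIntegral_ratH_mul` — the invariance.

No definition, no instance, no named fact; axioms ⊆ {propext, Classical.choice, Quot.sound}.

## References
* A. Weil, *Sur certains groupes d'opérateurs unitaires*, Acta Math. 111 (1964), Chap. III n° 41 Thm. 6 p. 193 [Weil1964].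
* Y. Liu, *Fourier–Jacobi cycles and arithmetic relative trace formula*, Camb. J. Math. 9 (2021), App. B (B.7), Prop. B.8 p. 104 [Liu2021].
* S. Gelbart, J. Rogawski, Invent. Math. 105 (1991), §3.1 Prop. 3.1.1 p. 455, §3.2 p. 457 [GelbartRogawski1991].

HONEST LABEL: HC_CM is proved only modulo the 7 printed citations (2 remaining named inputs: hLiu418 =
stmt-HodgeConjecture-24832, h413 = stmt-HodgeConjecture-24833) until rung 0 closes; this helper moves no counter.
-/

noncomputable section

set_option autoImplicit false

set_option linter.dupNamespace false

open NumberField MeasureTheory IsDedekindDomain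
open scoped Matrix ComplexOrder

namespace Summit.HodgeConjecture.HodgeConjecture.Cruxes.HLiu418.K2LiuDoubledLineThetaAutomorphic

open Literature.NumberTheory.Automorphic Literature.NumberTheory.Automorphic.UnitaryGroup
open Literature.NumberTheory.Automorphic.IdeleClassGroup
open Literature.NumberTheory.Automorphic.Liu2021
open Literature.NumberTheory.Automorphic.Liu2021.Def411WeilCarriers
open Literature.NumberTheory.Automorphic.Liu2021.Def411WeilCarriersDoubling
open Literature.NumberTheory.GelbartRogawski1991 Literature.NumberTheory.GelbartRogawski1991.UnitaryDualPair
open Literature.NumberTheory.GelbartRogawski1991.GRConstruction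
open Literature.NumberTheory.Weil1964
open Literature.RepresentationTheory.Liu2021
open Literature.NumberTheory.K2Lit.DoubledLineTheta

/-! ## §1 Rational points under an equality of forms -/

/-- **Transport of rational points along an equality of forms.** If `J = J'` then the identity transport
`MulEquiv.subgroupCongr : U(J)(𝔸_F) ≃* U(J')(𝔸_F)` carries the image of `U(J)(F)` into the image of `U(J')(F)`.
[cite: GelbartRogawski1991, §3.1 Prop. 3.1.1 p. 455] -/
theorem subgroupCongr_mem_range_toAdelic {F E : Type} [Field F] [NumberField F] [Field E] [NumberField E] [Algebra F E]
    (c : E ≃ₐ[F] E) (N : ℕ) {J J' : Matrix (Fin N) (Fin N) E} (hJ : J = J')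
    (h : UnitaryGroup.adelic F E c N J = UnitaryGroup.adelic F E c N J')
    {x : ↥(UnitaryGroup.adelic F E c N J)} (hx : x ∈ (UnitaryGroup.toAdelic F E c N J).range) :
    MulEquiv.subgroupCongr h x ∈ (UnitaryGroup.toAdelic F E c N J').range := by
  subst hJ
  obtain ⟨g, rfl⟩ := hx
  refine ⟨g, Subtype.ext ?_⟩
  rw [MulEquiv.subgroupCongr_apply]

variable (L : Type) [Field L] [NumberField L] [IsCMField L]
variable {N M n : ℕ} (e : Fin N × Fin M ≃ Fin n)
  (dV : Fin N → L) (hdV : ∀ i, IsCMField.complexConj L (dV i) = dV i)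
  (dW : Fin M → L) (hdW : ∀ i, IsCMField.complexConj L (dW i) = dW i)

/-- **`toDiagA` maps `H(L⁺)` to `U(diagonal dD)(L⁺)`**: for `γ` in ★ `ratH` (the image of `U(J^𝔻)(L⁺)` in `H(𝔸)`), `toDiagA γ` is in the image of
`U(diagonal dD)(L⁺)` (★ `toDiagA` is `MulEquiv.subgroupCongr adelic_hermD_eq`, and `J^𝔻 = diagonal dD` is ★ `hermD_eq_diagonal_dD`).
[cite: GelbartRogawski1991, §3.1 Prop. 3.1.1 p. 455] -/
theorem toDiagA_mem_range_toAdelic (γ : ratH L e dV hdV dW hdW) :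
    toDiagA L e dV hdV dW hdW (γ : HA L e dV hdV dW hdW) ∈
      (UnitaryGroup.toAdelic (Fp L) L (IsCMField.complexConj L) (n + n) (Matrix.diagonal (dD L e dV hdV dW hdW))).range := by
  rw [toDiagA]
  exact subgroupCongr_mem_range_toAdelic (IsCMField.complexConj L) (n + n) (hermD_eq_diagonal_dD L e dV hdV dW hdW)
    (adelic_hermD_eq L e dV hdV dW hdW) γ.2

/-! ## §2 Left `H(L⁺)`-invariance of the doubled theta lift and of the theta integral -/

variable {n'' : ℕ} (e₁ : Fin (n + n) × Fin 1 ≃ Fin n'') (hdV0 : ∀ i, dV i ≠ 0) (hdW0 : ∀ i, dW i ≠ 0)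
  (lam : Literature.NumberTheory.Automorphic.IdeleClassGroup L →ₜ* Circle) (hlam : IsConjugateSymplectic L lam)
  (a' : (↥(maximalRealSubfield L))ˣ)

/-- **Automorphy of the doubled line theta lift in `h`**: `Θ̃_Φ(f)(γ h) = Θ̃_Φ(f)(h)` for `γ ∈ H(L⁺)` — the kernel is read at the coset
`(toDiagA h)⁻¹ · U(𝔻)(L⁺)` and `(γ h)⁻¹ U(𝔻)(L⁺) = h⁻¹ γ⁻¹ U(𝔻)(L⁺) = h⁻¹ U(𝔻)(L⁺)`. [cite: Weil1964, Chap. III n° 41 Thm. 6 p. 193]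
[cite: Liu2021, App. B (B.7) p. 104] -/
theorem doubledLineThetaLift_ratH_mul
    (hρ : HasThetaMajorants fun
      (p : ↥(UnitaryGroup.adelic (Fp L) L (IsCMField.complexConj L) (n + n) (Matrix.diagonal (dD L e dV hdV dW hdW))) ×
        ↥(UnitaryGroup.adelic (Fp L) L (IsCMField.complexConj L) 1 (JW (Fp L) L a')))
      (Φ : piSchwartzBruhat (Fp L) (Fin n'')) =>
        pairRep (Fp L) L (IsCMField.complexConj L) (n + n) 1 e₁ (Matrix.diagonal (dD L e dV hdV dW hdW)) (JW (Fp L) L a')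
          (chiSplittingLine L e₁ (dD L e dV hdV dW hdW) (dD_conj L e dV hdV dW hdW) (dD_ne_zero L e dV hdV dW hdW hdV0 hdW0)
            (toHeckeCharacter L lam) (isUnitary_toHeckeCharacter L lam)
            ((isOscillatorChar_toHeckeCharacter_iff lam).mpr hlam) (TW (Fp L) a')
            (isUnit_det_TW (Fp L) a') (JW (Fp L) L a') (JW_eq (Fp L) L a'))
          p Φ)
    [MeasurableSpace (↥(UnitaryGroup.adelic (Fp L) L (IsCMField.complexConj L) 1 (JW (Fp L) L a')) ⧸
      (UnitaryGroup.toAdelic (Fp L) L (IsCMField.complexConj L) 1 (JW (Fp L) L a')).range)]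
    (μW : Measure (↥(UnitaryGroup.adelic (Fp L) L (IsCMField.complexConj L) 1 (JW (Fp L) L a')) ⧸
      (UnitaryGroup.toAdelic (Fp L) L (IsCMField.complexConj L) 1 (JW (Fp L) L a')).range))
    (Φ : piSchwartzBruhat (Fp L) (Fin n''))
    (f : C(↥(UnitaryGroup.adelic (Fp L) L (IsCMField.complexConj L) 1 (JW (Fp L) L a')) ⧸
      (UnitaryGroup.toAdelic (Fp L) L (IsCMField.complexConj L) 1 (JW (Fp L) L a')).range, ℂ))
    (γ : ratH L e dV hdV dW hdW) (h : HA L e dV hdV dW hdW) :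
    doubledLineThetaLift L e dV hdV dW hdW e₁ hdV0 hdW0 lam hlam a' hρ μW Φ f ((γ : HA L e dV hdV dW hdW) * h) =
      doubledLineThetaLift L e dV hdV dW hdW e₁ hdV0 hdW0 lam hlam a' hρ μW Φ f h := by
  rw [doubledLineThetaLift_apply, doubledLineThetaLift_apply]
  have hq : (QuotientGroup.mk (toDiagA L e dV hdV dW hdW ((γ : HA L e dV hdV dW hdW) * h))⁻¹ :
      ↥(UnitaryGroup.adelic (Fp L) L (IsCMField.complexConj L) (n + n) (Matrix.diagonal (dD L e dV hdV dW hdW))) ⧸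
        (UnitaryGroup.toAdelic (Fp L) L (IsCMField.complexConj L) (n + n) (Matrix.diagonal (dD L e dV hdV dW hdW))).range) =
      QuotientGroup.mk (toDiagA L e dV hdV dW hdW h)⁻¹ := by
    rw [map_mul, mul_inv_rev]
    refine QuotientGroup.eq.2 ?_
    rw [mul_inv_rev, inv_inv, inv_inv, mul_assoc, mul_inv_cancel, mul_one]
    exact toDiagA_mem_range_toAdelic L e dV hdV dW hdW γ
  simp_rw [hq]

/-- **Automorphy of the doubled theta integral in `h`**: `I(γ h; Φ) = I(h; Φ)` for `γ ∈ H(L⁺)` (the weight-`1` case of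
`doubledLineThetaLift_ratH_mul`; ★ `doubledLineThetaIntegral_eq_lift`). This is the invariance socket #42's residue `R` inherits term by term.
[cite: Weil1964, Chap. III n° 41 Thm. 6 p. 193] [cite: Liu2021, App. B (B.7), Prop. B.8 p. 104] -/
theorem doubledLineThetaIntegral_ratH_mul
    (hρ : HasThetaMajorants fun
      (p : ↥(UnitaryGroup.adelic (Fp L) L (IsCMField.complexConj L) (n + n) (Matrix.diagonal (dD L e dV hdV dW hdW))) ×
        ↥(UnitaryGroup.adelic (Fp L) L (IsCMField.complexConj L) 1 (JW (Fp L) L a')))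
      (Φ : piSchwartzBruhat (Fp L) (Fin n'')) =>
        pairRep (Fp L) L (IsCMField.complexConj L) (n + n) 1 e₁ (Matrix.diagonal (dD L e dV hdV dW hdW)) (JW (Fp L) L a')
          (chiSplittingLine L e₁ (dD L e dV hdV dW hdW) (dD_conj L e dV hdV dW hdW) (dD_ne_zero L e dV hdV dW hdW hdV0 hdW0)
            (toHeckeCharacter L lam) (isUnitary_toHeckeCharacter L lam)
            ((isOscillatorChar_toHeckeCharacter_iff lam).mpr hlam) (TW (Fp L) a')
            (isUnit_det_TW (Fp L) a') (JW (Fp L) L a') (JW_eq (Fp L) L a'))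
          p Φ)
    [MeasurableSpace (↥(UnitaryGroup.adelic (Fp L) L (IsCMField.complexConj L) 1 (JW (Fp L) L a')) ⧸
      (UnitaryGroup.toAdelic (Fp L) L (IsCMField.complexConj L) 1 (JW (Fp L) L a')).range)]
    (μW : Measure (↥(UnitaryGroup.adelic (Fp L) L (IsCMField.complexConj L) 1 (JW (Fp L) L a')) ⧸
      (UnitaryGroup.toAdelic (Fp L) L (IsCMField.complexConj L) 1 (JW (Fp L) L a')).range))
    (Φ : piSchwartzBruhat (Fp L) (Fin n'')) (γ : ratH L e dV hdV dW hdW) (h : HA L e dV hdV dW hdW) :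
    doubledLineThetaIntegral L e dV hdV dW hdW e₁ hdV0 hdW0 lam hlam a' hρ μW Φ ((γ : HA L e dV hdV dW hdW) * h) =
      doubledLineThetaIntegral L e dV hdV dW hdW e₁ hdV0 hdW0 lam hlam a' hρ μW Φ h := by
  rw [doubledLineThetaIntegral_eq_lift]
  exact doubledLineThetaLift_ratH_mul L e dV hdV dW hdW e₁ hdV0 hdW0 lam hlam a' hρ μW Φ 1 γ h

end Summit.HodgeConjecture.HodgeConjecture.Cruxes.HLiu418.K2LiuDoubledLineThetaAutomorphic

end
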